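import Summits.CriticalPhenomena.CardyFormulaZ2.Theorems.CardySusyWardWeakHolomorphyKirchhoffPairing
import Summits.CriticalPhenomena.CardyFormulaZ2.Theorems.CardySusyWardParafermionFamiliesToSLESixHalfCRVertexRelationPathwise
import Summits.CriticalPhenomena.CardyFormulaZ2.Theorems.CardySusyWardParafermionPrecompactVertexRelationGeometry
import Summits.CriticalPhenomena.CardyFormulaZ2.Theorems.CardySusyWardWeakHolomorphyFlipInvariance
import Literature.Probability.LatticeModels.MedialInterfaceMeasurability
import Literature.Barriers.CriticalPhenomena.FKParafermionicHalfCauchyRiemann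

/-! # The Kirchhoff defect of the spin-`1/3` dart observable is the once-visit chirality combination

Line `Sketch` of the crux `CardySusyWard.WeakHolomorphy` (stmt-CriticalPhenomena-11292), stub `stub_kirchhoffIdentity` (v5):
at an interior medial vertex `z` (a free lattice edge `e`) of hole-free `ℤ²`-admissible Dobrushin data,
`in(z) − out(z) = κ_L Z_L(z) + κ_R Z_R(z)` for the spin-`1/3` dart observable `bondDartObservable E δ (1/3)` (`DartPhase.lean`),
`Z_t = onceChiralObs`, `κ_t = onceKappa` (`OnceChiralPhase.lean`; Zhou 2024, eq. (102), resolved by chirality).  Proof: pair `ω`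
with its flip `ω ∆ {e}` (`integral_comp_symmDiff`); pathwise (`kval_add_kval_toggle`: `cornerOrbit_toggle_case0`,
`S2.one_of_both`, and the pair template `kval_case1` + `onceChiralPhase_explorationList_once/twice/never` of the helper file
`…WeakHolomorphyKirchhoffPairing`) `kval − T` is odd under the flip, so it integrates to zero; the two sides are identified
with the statement by `dartPhaseSum_explorationList` (the dart phase sum of the cut orbit is `S2.dartW`) and linearity.
-/

noncomputable section

namespace Summit.CriticalPhenomena.CardyFormulaZ2.Theorems.WeakHolomorphy.SplitBypass

open scoped BigOperators symmDiff
open MeasureTheory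
open _root_.Literature.Probability.LatticeModels
open _root_.Literature.Probability.Percolation (BondConfig bondPercolation half)
open _root_.Literature.Barriers.CriticalPhenomena (medialCornersAt medialVertexOf)
open Summit.CriticalPhenomena.CardyFormulaZ2.Theorems.ParafermionFamiliesToSLESix.StripAnchored.S2
  (dartW sixthPhase loopTurn_eq one_of_both)
open Summit.CriticalPhenomena.CardyFormulaZ2.Cruxes.ParafermionPrecompact.KenyonStreamSecondRelation
  (dartPhaseSum_explorationList toggle_hypotheses_symmDiff)
open _root_.Literature.Probability.LatticeModels.DiscreteDobrushin (startCorner exitTime isStartCorner_startCorner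
  medialExploration_eq_explorationList isInnerFace_of_lt_exitTime not_isInnerFace_exitTime)

/-! ## Local bookkeeping: interior vertices, the dart phase sum of a cut orbit, integrability -/

section Local

variable {E : DiscreteDobrushin}

/-- **Both endpoints of an interior medial vertex are interior sites**: if the edge `s(x, x + eᵢ)` of `Ω_δ` has no
endpoint on the arcs and both faces containing it are inner, all eight faces at its endpoints are inner. [cite: Smirnov2001, §2] -/
theorem isInnerFace_faceAt_of_interior (hE : E.IsZdAdmissible) {p : Site 2 × Fin 2}
    (hp : medialVertexOf p ∈ (discreteDomainGraph E.Ω E.δ).edgeSet ∧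
      (∀ x ∈ medialVertexOf p, x ∉ E.zdArcA ∧ x ∉ E.zdArcB) ∧
      ∀ f : Site 2, IsCorner p.1 f → IsCorner (p.1 + Pi.single p.2 1) f → E.IsInnerFace f) :
    (∀ j, E.IsInnerFace (faceAt p.1 j)) ∧ ∀ j, E.IsInnerFace (faceAt (p.1 + Pi.single p.2 1) j) := by
  obtain ⟨hedge, harc, hfaces⟩ := hp
  have hinner : medialVertexOf p ∈ E.innerMedialVertices := ⟨hedge, harc⟩
  have hx0 : p.1 ∉ E.zdBoundary := not_mem_zdBoundary_of_mem_inner hE hinner (Sym2.mem_mk_left _ _)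
  have hy0 : p.1 + Pi.single p.2 1 ∉ E.zdBoundary := not_mem_zdBoundary_of_mem_inner hE hinner (Sym2.mem_mk_right _ _)
  obtain ⟨k, hk⟩ : ∃ k : Fin 4, cornerUnit k = Pi.single p.2 1 := by
    obtain ⟨x, i⟩ := p; fin_cases i; exacts [⟨0, rfl⟩, ⟨1, rfl⟩]
  have hf : E.IsInnerFace (faceAt p.1 k) :=
    hfaces _ (isCorner_faceAt p.1 k) (by rw [← hk]; exact (isCorner_add_faceAt_iff p.1 k k).2 (Or.inl rfl))
  have hx : ∀ j, E.IsInnerFace (faceAt p.1 j) := (E.faces_dichotomy hx0).resolve_right fun h => h k hf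
  have hf' : E.IsInnerFace (faceAt (p.1 + Pi.single p.2 1) (k + 1)) := by
    rw [← hk, faceAt_add_unit_succ]; exact hf
  exact ⟨hx, (E.faces_dichotomy hy0).resolve_right fun h => h (k + 1) hf'⟩

/-- **The spin-`1/3` dart phase sum of a cut orbit at a coded corner `(q.1, cFace q)` is the dart weight `S2.dartW q`**
(`dartPhaseSum_explorationList`, and `𝓊^{-C} = sixthPhase C` for `𝓊 = e^{iπ/6}`). [cite: Smirnov2010, §2.2 eq. (2.2)] -/
theorem dartPhaseSum_eq_dartW {β : BondConfig (Site 2)} {c₀ : Site 2 × Fin 4} {δ : ℝ} (hδ : δ ≠ 0)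
    (N : ℕ) (q : Site 2 × Fin 4) (c : Site 2 × Site 2) (h1 : c.1 = q.1) (h2 : c.2 = cFace q) :
    dartPhaseSum (explorationList β c₀ N) δ (1 / 3) c = dartW β c₀ q N := by
  classical
  obtain rfl : c = (q.1, cFace q) := Prod.ext h1 h2
  rw [dartPhaseSum_explorationList hδ β c₀ N q]
  unfold dartW
  refine Finset.sum_congr ?_ fun j _ => ?_
  · ext j; simp only [Finset.mem_filter, Finset.mem_range]
  · rw [sixthPhase, ← Complex.exp_int_mul]; congr 1; push_cast; ring

/-- The dart phase sum of the exploration path is `P_{1/2}`-integrable (bounded by `1`, measurable in the path). [folklore] -/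
theorem integrable_dartPhaseSum_exploration (E : DiscreteDobrushin) (δ σ : ℝ) (c : Site 2 × Site 2) :
    Integrable (fun ω => dartPhaseSum (medialExploration E ω) δ σ c) (bondPercolation (zdGraph 2) half) :=
  Integrable.of_bound
    (measurable_of_medialExploration E (F := fun ω => dartPhaseSum (medialExploration E ω) δ σ c)
      (fun _ _ h => by simp only [h])).aestronglyMeasurable 1
    (ae_of_all _ fun ω => Parafermion.norm_dartPhaseSum_le_one (Parafermion.nodup_zip_tail_medialExploration E ω) δ σ c)

/-- The once-visit chiral phase has norm at most `1` (one unimodular term, or none). [folklore] -/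
theorem norm_onceChiralPhase_le_one (γ : List MedialVertex) (δ σ : ℝ) (z : MedialVertex) (b : Bool) :
    ‖onceChiralPhase γ δ σ z b‖ ≤ 1 := by
  classical
  unfold onceChiralPhase
  by_cases h1 : (passagePositions γ z).card = 1
  · obtain ⟨a, ha⟩ := Finset.card_eq_one.1 h1
    rw [ha, Finset.sum_singleton]
    split_ifs
    · exact (Parafermion.norm_exp_neg_I_mul_ofReal_mul_ofReal _ _).le
    · simp
  · rw [Finset.sum_eq_zero fun k _ => if_neg fun h => h1 h.1, norm_zero]; exact zero_le_one

/-- The once-visit chiral phase of the exploration path is `P_{1/2}`-integrable, for every datum. [folklore] -/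
theorem integrable_onceChiralPhase_exploration (E : DiscreteDobrushin) (δ σ : ℝ) (z : MedialVertex) (b : Bool) :
    Integrable (fun ω => onceChiralPhase (medialExploration E ω) δ σ z b) (bondPercolation (zdGraph 2) half) :=
  Integrable.of_bound
    (measurable_of_medialExploration E (F := fun ω => onceChiralPhase (medialExploration E ω) δ σ z b)
      (fun _ _ h => by simp only [h])).aestronglyMeasurable 1
    (ae_of_all _ fun ω => norm_onceChiralPhase_le_one _ δ σ z b)

end Local

/-! ## The pathwise pair identity `kval(ω) + kval(ω') = T(ω) + T(ω')`

Along a cut orbit, the KIRCHHOFF DEFECT `kval` at `e = cTgt r` is `W(r) + W(r₂) − W(r.1, r.2+1) − W(r₂.1, r₂.2+1)`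
(`W = S2.dartW`, `r₂ = cornerPartner r`, as in `kval_case1`) and the ONCE-VISIT TERM `T` is
`κ_L · onceChiralPhase … (cTgt r) true + κ_R · onceChiralPhase … (cTgt r) false`; both are written out in full. -/

section Pathwise

variable {E : DiscreteDobrushin}

/-- **The pair identity from the once side**, with the once-visit term read on the two cut orbits:
`r = orb i₁` is a dart of the exploration of `ω`, its partner is not, `ω'` is `ω` flipped at
`e = cTgt r` (interior, hole-free inner faces); then `kval(ω) + kval(ω') = T(ω)` — the once-visit term
of `ω` — and the once-visit phases of `ω'` (which visits `e` twice) vanish.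
[cite: Zhou2024SLE6BondZ2, eq. (102)] -/
theorem kval_pair_of_once (hE : E.IsZdAdmissible) (hH : HoleFree {f : Site 2 | E.IsInnerFace f})
    {r : Site 2 × Fin 4} (hB : ∀ x ∈ cTgt r, x ∉ E.zdArcB)
    (hx : ∀ j, E.IsInnerFace (faceAt r.1 j)) (hy : ∀ j, E.IsInnerFace (faceAt (r.1 + cornerUnit (r.2 + 1)) j))
    {ω ω' : BondConfig (Site 2)}
    (hagree : ∀ e, e ≠ cTgt r → (e ∈ E.bcBondConfig ω' ↔ e ∈ E.bcBondConfig ω))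
    (hdiff : ¬ (cTgt r ∈ E.bcBondConfig ω' ↔ cTgt r ∈ E.bcBondConfig ω)) {i₁ : ℕ}
    (hi₁ : cornerOrbit (E.bcBondConfig ω) (startCorner hE) i₁ = r) (hi₁N : i₁ < exitTime hE ω)
    (h₂ : ∀ i < exitTime hE ω, cornerOrbit (E.bcBondConfig ω) (startCorner hE) i ≠ cornerPartner r)
    {δ : ℝ} (hδ : δ ≠ 0) :
    (dartW (E.bcBondConfig ω) (startCorner hE) r (exitTime hE ω) + dartW (E.bcBondConfig ω) (startCorner hE) (cornerPartner r) (exitTime hE ω) -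
        dartW (E.bcBondConfig ω) (startCorner hE) (r.1, r.2 + 1) (exitTime hE ω) -
        dartW (E.bcBondConfig ω) (startCorner hE) ((cornerPartner r).1, (cornerPartner r).2 + 1) (exitTime hE ω)) +
        (dartW (E.bcBondConfig ω') (startCorner hE) r (exitTime hE ω') + dartW (E.bcBondConfig ω') (startCorner hE) (cornerPartner r) (exitTime hE ω') -
          dartW (E.bcBondConfig ω') (startCorner hE) (r.1, r.2 + 1) (exitTime hE ω') -
          dartW (E.bcBondConfig ω') (startCorner hE) ((cornerPartner r).1, (cornerPartner r).2 + 1) (exitTime hE ω')) =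
      (onceKappa true * onceChiralPhase (explorationList (E.bcBondConfig ω) (startCorner hE) (exitTime hE ω)) δ (1 / 3) (cTgt r) true +
        onceKappa false * onceChiralPhase (explorationList (E.bcBondConfig ω) (startCorner hE) (exitTime hE ω)) δ (1 / 3) (cTgt r) false) ∧
    ∀ b, onceChiralPhase (explorationList (E.bcBondConfig ω') (startCorner hE) (exitTime hE ω')) δ (1 / 3)
      (cTgt r) b = 0 := by
  have hc₀ := isStartCorner_startCorner hE
  have hN := not_isInnerFace_exitTime hE ω
  have hlt : ∀ k < exitTime hE ω, E.IsInnerFace (cFace (cornerOrbit (E.bcBondConfig ω) (startCorner hE) k)) :=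
    fun k hk => isInnerFace_of_lt_exitTime hE ω hk
  have hc₀m : (startCorner hE).1 ∈ meshDomain E.Ω E.δ :=
    E.zdBoundary_subset_meshDomain (E.zdArcA_subset_zdBoundary hc₀.mem_zdArcA)
  obtain ⟨P, hP0, hP, hPmin⟩ := exists_min_period hE ω hc₀m
  have hym : (cornerPartner r).1 ∈ meshDomain E.Ω E.δ :=
    fst_mem_meshDomain_of_isInnerFace (q := cornerPartner r) (hy _)
  obtain ⟨Q, hQ0, hQ, hQmin⟩ := exists_min_period hE ω hym
  obtain ⟨hpre, hloop, -, hin', hout'⟩ := cornerOrbit_toggle_case1 hE hc₀ hagree hdiff hx hy hN hlt hP0 hP hPmin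
    hQ0 hQ hQmin hi₁ hi₁N h₂
  have hN' : exitTime hE ω' = exitTime hE ω + Q := exitTime_eq_of hE ω' hout' hin'
  have hLin : ∀ m, E.IsInnerFace (cFace (cornerOrbit (E.bcBondConfig ω) (cornerPartner r) m)) := by
    intro m
    rw [← cornerOrbit_mod_period hQ m]
    rcases Nat.eq_zero_or_pos (m % Q) with h0 | hpos
    · rw [h0]; exact (hy _ : E.IsInnerFace (cFace (cornerPartner r)))
    · obtain ⟨j, hj⟩ : ∃ j, m % Q = j + 1 := ⟨m % Q - 1, by omega⟩
      have hjQ : j + 1 ≤ Q := by have := Nat.mod_lt m hQ0; omega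
      rw [hj, ← hloop j hjQ]
      exact hin' _ (by omega)
  have hdisj : ∀ m i, i < exitTime hE ω →
      cornerOrbit (E.bcBondConfig ω) (cornerPartner r) m ≠ cornerOrbit (E.bcBondConfig ω) (startCorner hE) i :=
    fun m i _ => loop_ne_of_never_arrives hE hc₀ hy hN hlt hP0 hP hPmin h₂ m i
  have hS := loopTurn_eq hH hc₀ hx hN hQ0 hQ hQmin hLin hdisj hi₁ hi₁N
  have hpair := kval_case1 hE hc₀ hagree hdiff hB hx hy hN hlt hP0 hP hPmin hQ0 hQ hQmin hi₁ hi₁N h₂ hS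
  have hi₁N' : i₁ + 1 < exitTime hE ω := succ_lt_of_arrives hN hx hi₁ hi₁N
  have uP : ∀ j < exitTime hE ω, cornerOrbit (E.bcBondConfig ω) (startCorner hE) j = r → j = i₁ := by
    intro j hj h
    by_contra hne
    rcases Nat.lt_or_gt_of_ne hne with hab | hab
    · exact cornerOrbit_ne hE hc₀ hab (fun k hk => hlt k (by omega)) (h.trans hi₁.symm)
    · exact cornerOrbit_ne hE hc₀ hab (fun k hk => hlt k (by omega)) (hi₁.trans h.symm)
  have hloopQ : cornerOrbit (E.bcBondConfig ω') (startCorner hE) (i₁ + Q) = cornerPartner r := by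
    have := hloop (Q - 1) (by omega)
    rwa [show i₁ + 1 + (Q - 1) = i₁ + Q by omega, Nat.sub_add_cancel hQ0, hQ] at this
  rw [hN']
  refine ⟨?_, fun b => onceChiralPhase_explorationList_twice (by omega : i₁ ≠ i₁ + Q) ((hpre i₁ le_rfl).trans hi₁)
    (by omega) hloopQ (by omega) b⟩
  rw [hpair, onceChiralPhase_explorationList_once hδ hi₁ hi₁N' uP h₂ true,
    onceChiralPhase_explorationList_once hδ hi₁ hi₁N' uP h₂ false]
  by_cases he : cTgt r ∈ E.bcBondConfig ω
  · simp [he, turnSign_of_mem he]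
  · simp [he, turnSign_of_not_mem he]

/-- **The pathwise pair identity, all cases.** At an edge `e = cTgt r` all of whose endpoints' faces are inner
and with no endpoint on the arc `B`, for hole-free admissible data, configurations `ω`, `ω'` whose completions agree
off `e` and differ at `e`, and every reading mesh `δ ≠ 0`: `kval(ω) + kval(ω') = T(ω) + T(ω')` (cases never/never,
once/twice, twice/once by `S2.one_of_both`, for `r` or for its partner). [cite: Zhou2024SLE6BondZ2, eq. (102)] -/
theorem kval_add_kval_toggle (hE : E.IsZdAdmissible) (hH : HoleFree {f : Site 2 | E.IsInnerFace f}) {r : Site 2 × Fin 4}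
    (hB : ∀ x ∈ cTgt r, x ∉ E.zdArcB)
    (hx : ∀ j, E.IsInnerFace (faceAt r.1 j)) (hy : ∀ j, E.IsInnerFace (faceAt (r.1 + cornerUnit (r.2 + 1)) j))
    {ω ω' : BondConfig (Site 2)} (hagree : ∀ e, e ≠ cTgt r → (e ∈ E.bcBondConfig ω' ↔ e ∈ E.bcBondConfig ω))
    (hdiff : ¬ (cTgt r ∈ E.bcBondConfig ω' ↔ cTgt r ∈ E.bcBondConfig ω)) {δ : ℝ} (hδ : δ ≠ 0) :
    (dartW (E.bcBondConfig ω) (startCorner hE) r (exitTime hE ω) + dartW (E.bcBondConfig ω) (startCorner hE) (cornerPartner r) (exitTime hE ω) -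
        dartW (E.bcBondConfig ω) (startCorner hE) (r.1, r.2 + 1) (exitTime hE ω) -
        dartW (E.bcBondConfig ω) (startCorner hE) ((cornerPartner r).1, (cornerPartner r).2 + 1) (exitTime hE ω)) +
        (dartW (E.bcBondConfig ω') (startCorner hE) r (exitTime hE ω') + dartW (E.bcBondConfig ω') (startCorner hE) (cornerPartner r) (exitTime hE ω') -
          dartW (E.bcBondConfig ω') (startCorner hE) (r.1, r.2 + 1) (exitTime hE ω') -
          dartW (E.bcBondConfig ω') (startCorner hE) ((cornerPartner r).1, (cornerPartner r).2 + 1) (exitTime hE ω')) =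
      (onceKappa true * onceChiralPhase (explorationList (E.bcBondConfig ω) (startCorner hE) (exitTime hE ω)) δ (1 / 3) (cTgt r) true +
        onceKappa false * onceChiralPhase (explorationList (E.bcBondConfig ω) (startCorner hE) (exitTime hE ω)) δ (1 / 3) (cTgt r) false) +
        (onceKappa true * onceChiralPhase (explorationList (E.bcBondConfig ω') (startCorner hE) (exitTime hE ω')) δ (1 / 3) (cTgt r) true +
          onceKappa false * onceChiralPhase (explorationList (E.bcBondConfig ω') (startCorner hE) (exitTime hE ω')) δ (1 / 3) (cTgt r) false) := by
  have hc₀ := isStartCorner_startCorner hE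
  -- the same data for the partner
  have hyx : (cornerPartner r).1 + cornerUnit ((cornerPartner r).2 + 1) = r.1 := by
    change r.1 + cornerUnit (r.2 + 1) + cornerUnit (r.2 + 2 + 1) = r.1
    rw [show r.2 + 2 + 1 = (r.2 + 1) + 2 by omega, cornerUnit_add_two]; abel
  have hx2 : ∀ j, E.IsInnerFace (faceAt (cornerPartner r).1 j) := hy
  have hy2 : ∀ j, E.IsInnerFace (faceAt ((cornerPartner r).1 + cornerUnit ((cornerPartner r).2 + 1)) j) := by
    rw [hyx]; exact hx
  have hB2 : ∀ x ∈ cTgt (cornerPartner r), x ∉ E.zdArcB := by rw [cTgt_partner]; exact hB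
  have hagree2 : ∀ e, e ≠ cTgt (cornerPartner r) → (e ∈ E.bcBondConfig ω' ↔ e ∈ E.bcBondConfig ω) := by
    rw [cTgt_partner]; exact hagree
  have hdiff2 : ¬ (cTgt (cornerPartner r) ∈ E.bcBondConfig ω' ↔ cTgt (cornerPartner r) ∈ E.bcBondConfig ω) := by
    rw [cTgt_partner]; exact hdiff
  have hN := not_isInnerFace_exitTime hE ω
  have hlt : ∀ k < exitTime hE ω, E.IsInnerFace (cFace (cornerOrbit (E.bcBondConfig ω) (startCorner hE) k)) :=
    fun k hk => isInnerFace_of_lt_exitTime hE ω hk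
  by_cases h₁ : ∃ i, i < exitTime hE ω ∧ cornerOrbit (E.bcBondConfig ω) (startCorner hE) i = r
  · by_cases h₂ : ∃ i, i < exitTime hE ω ∧ cornerOrbit (E.bcBondConfig ω) (startCorner hE) i = cornerPartner r
    · -- twice in `ω`: once in the flipped configuration
      obtain ⟨i₁, hi₁N, hi₁⟩ := h₁
      obtain ⟨i₂, hi₂N, hi₂⟩ := h₂
      have hne : i₁ ≠ i₂ := by rintro rfl; exact partner_ne r (hi₂.symm.trans hi₁)
      rcases Nat.lt_or_gt_of_ne hne with h12 | h21
      · obtain ⟨⟨i, hiN', hi'⟩, h₂'⟩ := one_of_both hE hagree hdiff hi₁ hi₂ h12 hi₂N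
        obtain ⟨hk, hT⟩ := kval_pair_of_once hE hH hB hx hy (fun e hne => (hagree e hne).symm) (fun h => hdiff h.symm)
          hi' hiN' h₂' hδ
        rw [hT true, hT false]
        linear_combination hk
      · obtain ⟨⟨i, hiN', hi'⟩, h₁'⟩ := one_of_both (p := cornerPartner r) hE hagree2 hdiff2 hi₂
          (by rw [partner_partner]; exact hi₁) h21 hi₁N
        obtain ⟨hk, hT⟩ := kval_pair_of_once (r := cornerPartner r) hE hH hB2 hx2 hy2
          (fun e hne => (hagree2 e hne).symm) (fun h => hdiff2 h.symm) hi' hiN' h₁' hδ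
        rw [partner_partner, cTgt_partner] at hk
        rw [cTgt_partner] at hT
        rw [hT true, hT false]
        linear_combination hk
    · -- once in `ω`, along `r`
      obtain ⟨i₁, hi₁N, hi₁⟩ := h₁
      have h₂' : ∀ i < exitTime hE ω, cornerOrbit (E.bcBondConfig ω) (startCorner hE) i ≠ cornerPartner r :=
        fun i hi h => h₂ ⟨i, hi, h⟩
      obtain ⟨hk, hT⟩ := kval_pair_of_once hE hH hB hx hy hagree hdiff hi₁ hi₁N h₂' hδ
      rw [hT true, hT false]
      linear_combination hk
  · have h₁' : ∀ i < exitTime hE ω, cornerOrbit (E.bcBondConfig ω) (startCorner hE) i ≠ r :=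
      fun i hi h => h₁ ⟨i, hi, h⟩
    by_cases h₂ : ∃ i, i < exitTime hE ω ∧ cornerOrbit (E.bcBondConfig ω) (startCorner hE) i = cornerPartner r
    · -- once in `ω`, along the partner
      obtain ⟨i₂, hi₂N, hi₂⟩ := h₂
      have h₁'' : ∀ i < exitTime hE ω,
          cornerOrbit (E.bcBondConfig ω) (startCorner hE) i ≠ cornerPartner (cornerPartner r) := by
        rw [partner_partner]; exact h₁'
      obtain ⟨hk, hT⟩ := kval_pair_of_once (r := cornerPartner r) hE hH hB2 hx2 hy2 hagree2 hdiff2 hi₂ hi₂N h₁'' hδ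
      rw [partner_partner, cTgt_partner] at hk
      rw [cTgt_partner] at hT
      rw [hT true, hT false]
      linear_combination hk
    · -- never: the flipped exploration is the same path
      have h₂' : ∀ i < exitTime hE ω, cornerOrbit (E.bcBondConfig ω) (startCorner hE) i ≠ cornerPartner r :=
        fun i hi h => h₂ ⟨i, hi, h⟩
      have hcase := cornerOrbit_toggle_case0 (c₀ := startCorner hE) hagree hdiff h₁' h₂'
      have hN' : exitTime hE ω' = exitTime hE ω :=
        exitTime_eq_of hE _ (by rw [hcase _ le_rfl]; exact hN) (fun k hk => by rw [hcase k hk.le]; exact hlt k hk)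
      have h₁'' : ∀ i < exitTime hE ω, cornerOrbit (E.bcBondConfig ω') (startCorner hE) i ≠ r :=
        fun i hi h => h₁' i hi (by rw [← hcase i hi.le]; exact h)
      have h₂'' : ∀ i < exitTime hE ω, cornerOrbit (E.bcBondConfig ω') (startCorner hE) i ≠ cornerPartner r :=
        fun i hi h => h₂' i hi (by rw [← hcase i hi.le]; exact h)
      rw [hN', kval_case0 hc₀ hB h₁' h₂', kval_case0 (ω := ω') hc₀ hB h₁'' h₂'',
        onceChiralPhase_explorationList_never h₁' h₂', onceChiralPhase_explorationList_never h₁' h₂',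
        onceChiralPhase_explorationList_never h₁'' h₂'', onceChiralPhase_explorationList_never h₁'' h₂'']
      ring

/-- **Assembly**: a functional `H` of the configuration which is pathwise a constant multiple of
`kval − T` at an interior edge `e = cTgt r` (the four corners written as `r, q₂, q₃, q₄`) has zero expectation under
`P_{1/2}`: flipping `e` (`toggle_hypotheses_symmDiff`) gives `H ∘ flip = -H` by the pair identity, and `P_{1/2}` is flip
invariant (`integral_comp_symmDiff`). [cite: Zhou2024SLE6BondZ2, eq. (102)] -/
theorem integral_eq_zero_of_eq_mul_kval_sub (hE : E.IsZdAdmissible) (hH : HoleFree {f : Site 2 | E.IsInnerFace f})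
    {r : Site 2 × Fin 4} (hx : ∀ j, E.IsInnerFace (faceAt r.1 j))
    (hy : ∀ j, E.IsInnerFace (faceAt (r.1 + cornerUnit (r.2 + 1)) j)) (q₂ q₃ q₄ : Site 2 × Fin 4) (hq₂ : q₂ = cornerPartner r)
    (hq₃ : q₃ = (r.1, r.2 + 1)) (hq₄ : q₄ = ((cornerPartner r).1, (cornerPartner r).2 + 1)) (κ : ℂ) {δ : ℝ} (hδ : δ ≠ 0)
    (H : BondConfig (Site 2) → ℂ)
    (hHr : ∀ ω, H ω = κ * (dartW (E.bcBondConfig ω) (startCorner hE) r (exitTime hE ω) +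
      dartW (E.bcBondConfig ω) (startCorner hE) q₂ (exitTime hE ω) - dartW (E.bcBondConfig ω) (startCorner hE) q₃ (exitTime hE ω) -
      dartW (E.bcBondConfig ω) (startCorner hE) q₄ (exitTime hE ω) -
      (onceKappa true * onceChiralPhase (explorationList (E.bcBondConfig ω) (startCorner hE) (exitTime hE ω)) δ (1 / 3) (cTgt r) true +
        onceKappa false * onceChiralPhase (explorationList (E.bcBondConfig ω) (startCorner hE) (exitTime hE ω)) δ (1 / 3) (cTgt r) false))) :
    ∫ ω, H ω ∂(bondPercolation (zdGraph 2) half) = 0 := by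
  subst hq₂ hq₃ hq₄
  have hanti : ∀ ω, H (ω ∆ {cTgt r}) = -H ω := by
    intro ω
    obtain ⟨hagree, hdiff, hB⟩ := toggle_hypotheses_symmDiff hx hy ω
    rw [hHr, hHr]
    have := kval_add_kval_toggle hE hH hB hx hy hagree hdiff hδ
    linear_combination κ * this
  have h1 := integral_comp_symmDiff (cTgt_mem_edgeSet r) H
  simp only [hanti, integral_neg] at h1
  linear_combination (-1 / 2 : ℂ) * h1

end Pathwise

section Assembly

variable {E : DiscreteDobrushin}

/-- **The Kirchhoff defect minus the once-visit combination as one expectation**: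
`F(c₁) + F(c₃) − F(c₀) − F(c₂) − s (κ_L Z_L + κ_R Z_R)` is the expectation of the pathwise combination of the
dart phase sums and once-visit phases of the exploration path (all bounded functions of the path). [folklore] -/
theorem defect_eq_integral (E : DiscreteDobrushin) (c₀ c₁ c₂ c₃ : Site 2 × Site 2) (δ : ℝ) (s : ℂ) (z : MedialVertex) :
    bondDartObservable E δ (1 / 3) c₁ + bondDartObservable E δ (1 / 3) c₃ - bondDartObservable E δ (1 / 3) c₀ -
          bondDartObservable E δ (1 / 3) c₂ -
        s * (onceKappa true * onceChiralObs E δ (1 / 3) z true + onceKappa false * onceChiralObs E δ (1 / 3) z false) =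
      ∫ ω, (dartPhaseSum (medialExploration E ω) δ (1 / 3) c₁ + dartPhaseSum (medialExploration E ω) δ (1 / 3) c₃ -
          dartPhaseSum (medialExploration E ω) δ (1 / 3) c₀ - dartPhaseSum (medialExploration E ω) δ (1 / 3) c₂ -
        s * (onceKappa true * onceChiralPhase (medialExploration E ω) δ (1 / 3) z true +
          onceKappa false * onceChiralPhase (medialExploration E ω) δ (1 / 3) z false)) ∂(bondPercolation (zdGraph 2) half) := by
  have hint : ∀ c, Integrable (fun ω => dartPhaseSum (medialExploration E ω) δ (1 / 3) c) (bondPercolation (zdGraph 2) half) :=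
    fun c => integrable_dartPhaseSum_exploration E δ _ c
  have hT : ∀ b, Integrable (fun ω => onceKappa b * onceChiralPhase (medialExploration E ω) δ (1 / 3) z b)
      (bondPercolation (zdGraph 2) half) := fun b => (integrable_onceChiralPhase_exploration E δ _ z b).const_mul _
  have hAB : Integrable (fun ω => dartPhaseSum (medialExploration E ω) δ (1 / 3) c₁ +
      dartPhaseSum (medialExploration E ω) δ (1 / 3) c₃) (bondPercolation (zdGraph 2) half) := (hint _).add (hint _)
  have hABC : Integrable (fun ω => dartPhaseSum (medialExploration E ω) δ (1 / 3) c₁ +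
      dartPhaseSum (medialExploration E ω) δ (1 / 3) c₃ - dartPhaseSum (medialExploration E ω) δ (1 / 3) c₀)
      (bondPercolation (zdGraph 2) half) := hAB.sub (hint _)
  have hTT : Integrable (fun ω => s * (onceKappa true * onceChiralPhase (medialExploration E ω) δ (1 / 3) z true +
      onceKappa false * onceChiralPhase (medialExploration E ω) δ (1 / 3) z false)) (bondPercolation (zdGraph 2) half) :=
    ((hT true).add (hT false)).const_mul _
  have hABCD : Integrable (fun ω => dartPhaseSum (medialExploration E ω) δ (1 / 3) c₁ +
      dartPhaseSum (medialExploration E ω) δ (1 / 3) c₃ - dartPhaseSum (medialExploration E ω) δ (1 / 3) c₀ -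
      dartPhaseSum (medialExploration E ω) δ (1 / 3) c₂) (bondPercolation (zdGraph 2) half) := hABC.sub (hint _)
  simp only [Parafermion.bondDartObservable_def, onceChiralObs]
  rw [integral_sub hABCD hTT, integral_sub hABC (hint _), integral_sub hAB (hint _), integral_add (hint _) (hint _),
    integral_const_mul, integral_add (hT true) (hT false), integral_const_mul, integral_const_mul]

/-- **The Kirchhoff defect identity** at an interior medial vertex of hole-free `ℤ²`-admissible
Dobrushin data: `F(NE) + F(SW) − F(NW) − F(SE) = s_p (κ_L Z_L + κ_R Z_R)` for `F = bondDartObservable E δ (1/3)`,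
`s_p = 1` at a horizontal edge (incoming corners `NE`, `SW`) and `-1` at a vertical one (incoming `NW`, `SE`).
[cite: Zhou2024SLE6BondZ2, eq. (102)] -/
theorem kirchhoffIdentity (hE : E.IsZdAdmissible) (hH : HoleFree {f : Site 2 | E.IsInnerFace f})
    (p : Site 2 × Fin 2) (hp : medialVertexOf p ∈ (discreteDomainGraph E.Ω E.δ).edgeSet ∧
      (∀ x ∈ medialVertexOf p, x ∉ E.zdArcA ∧ x ∉ E.zdArcB) ∧
      ∀ f : Site 2, IsCorner p.1 f → IsCorner (p.1 + Pi.single p.2 1) f → E.IsInnerFace f) {δ : ℝ} (hδ : 0 < δ) :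
    bondDartObservable E δ (1 / 3) (medialCornersAt p.1 p.2 1) + bondDartObservable E δ (1 / 3) (medialCornersAt p.1 p.2 3) -
        bondDartObservable E δ (1 / 3) (medialCornersAt p.1 p.2 0) - bondDartObservable E δ (1 / 3) (medialCornersAt p.1 p.2 2) =
      (if p.2 = 0 then (1 : ℂ) else -1) *
        (onceKappa true * onceChiralObs E δ (1 / 3) (medialVertexOf p) true +
          onceKappa false * onceChiralObs E δ (1 / 3) (medialVertexOf p) false) := by
  classical
  obtain ⟨hx0, hy0⟩ := isInnerFace_faceAt_of_interior hE hp
  rw [← sub_eq_zero, defect_eq_integral E (medialCornersAt p.1 p.2 0) (medialCornersAt p.1 p.2 1)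
    (medialCornersAt p.1 p.2 2) (medialCornersAt p.1 p.2 3)]
  obtain ⟨x, i⟩ := p
  obtain rfl | rfl : i = 0 ∨ i = 1 := by fin_cases i <;> simp
  · -- horizontal medial vertex `s(x, x + e₀)`: arriving corners `(x + e₀, 1) = NE`, `r = (x, 3) = SW`
    refine integral_eq_zero_of_eq_mul_kval_sub hE hH (r := (x, 3)) hx0 hy0 (x + Pi.single 0 1, 1) (x, 0)
      (x + Pi.single 0 1, 2) rfl rfl rfl 1 hδ.ne' _ fun ω => ?_
    dsimp only
    rw [show medialVertexOf (x, (0 : Fin 2)) = cTgt (x, 3) from rfl, medialExploration_eq_explorationList hE ω,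
      dartPhaseSum_eq_dartW hδ.ne' _ (x, 0) (medialCornersAt x 0 0) rfl (by simp [medialCornersAt, cFace, faceAt, cornerOff]),
      dartPhaseSum_eq_dartW hδ.ne' _ (x + Pi.single 0 1, 2) (medialCornersAt x 0 2)
        (by simp [medialCornersAt]) (by simp [medialCornersAt, cFace, faceAt, cornerOff]; abel),
      dartPhaseSum_eq_dartW hδ.ne' _ (x + Pi.single 0 1, 1) (medialCornersAt x 0 1)
        (by simp [medialCornersAt]) (by simp [medialCornersAt, cFace, faceAt, cornerOff]),
      dartPhaseSum_eq_dartW hδ.ne' _ (x, 3) (medialCornersAt x 0 3) rfl (by simp [medialCornersAt, cFace, faceAt, cornerOff]),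
      if_pos rfl]
    ring
  · -- vertical medial vertex `s(x, x + e₁)`: arriving corners `(x + e₁, 2) = NW`, `r = (x, 0) = SE`
    refine integral_eq_zero_of_eq_mul_kval_sub hE hH (r := (x, 0)) hx0 hy0 (x + Pi.single 1 1, 2) (x, 1)
      (x + Pi.single 1 1, 3) rfl rfl rfl (-1) hδ.ne' _ fun ω => ?_
    dsimp only
    rw [show medialVertexOf (x, (1 : Fin 2)) = cTgt (x, 0) from rfl, medialExploration_eq_explorationList hE ω,
      dartPhaseSum_eq_dartW hδ.ne' _ (x + Pi.single 1 1, 2) (medialCornersAt x 1 0)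
        (by simp [medialCornersAt]) (by simp [medialCornersAt, cFace, faceAt, cornerOff]),
      dartPhaseSum_eq_dartW hδ.ne' _ (x, 0) (medialCornersAt x 1 2) rfl (by simp [medialCornersAt, cFace, faceAt, cornerOff]),
      dartPhaseSum_eq_dartW hδ.ne' _ (x + Pi.single 1 1, 3) (medialCornersAt x 1 1)
        (by simp [medialCornersAt]) (by simp [medialCornersAt, cFace, faceAt, cornerOff]),
      dartPhaseSum_eq_dartW hδ.ne' _ (x, 1) (medialCornersAt x 1 3) rfl (by simp [medialCornersAt, cFace, faceAt, cornerOff]),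
      if_neg (show ¬ ((1 : Fin 2) = 0) by decide)]
    ring

end Assembly

/-- **Registered stub `stub_kirchhoffIdentity` (v5)** — the Kirchhoff defect of the spin-`1/3` dart
observable `bondDartObservable` at an interior medial vertex of hole-free admissible data is the once-visit
chirality combination `s_p (κ_L Z_L + κ_R Z_R)` (exact, finite; Zhou 2024 eq. (102) resolved by chirality).
[cite: Zhou2024SLE6BondZ2, eq. (102)] -/
theorem stub_kirchhoffIdentity : ∀ (E : DiscreteDobrushin), E.IsZdAdmissible → HoleFree {f : Site 2 | E.IsInnerFace f} → ∀ p : Site 2 × Fin 2, (medialVertexOf p ∈ (discreteDomainGraph E.Ω E.δ).edgeSet ∧ (∀ x ∈ medialVertexOf p, x ∉ E.zdArcA ∧ x ∉ E.zdArcB) ∧ ∀ f : Site 2, IsCorner p.1 f → IsCorner (p.1 + Pi.single p.2 1) f → E.IsInnerFace f) → ∀ δ : ℝ, 0 < δ → bondDartObservable E δ (1 / 3) (medialCornersAt p.1 p.2 1) + bondDartObservable E δ (1 / 3) (medialCornersAt p.1 p.2 3) - bondDartObservable E δ (1 / 3) (medialCornersAt p.1 p.2 0) - bondDartObservable E δ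 (1 / 3) (medialCornersAt p.1 p.2 2) = (if p.2 = 0 then (1 : ℂ) else -1) * (onceKappa true * onceChiralObs E δ (1 / 3) (medialVertexOf p) true + onceKappa false * onceChiralObs E δ (1 / 3) (medialVertexOf p) false) :=
  fun _ hE hH p hp _ hδ => kirchhoffIdentity hE hH p hp hδ

end Summit.CriticalPhenomena.CardyFormulaZ2.Theorems.WeakHolomorphy.SplitBypass

end
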